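import Literature.AlgebraicGeometry.Resolution.Hironaka1964LocalBlowups
import Literature.AlgebraicGeometry.Resolution.ResolutionOfCurves
import Mathlib.AlgebraicGeometry.Morphisms.ClosedImmersion
import Mathlib.AlgebraicGeometry.Morphisms.QuasiSeparated
import HarnessLib

/-!
# The singular locus in the local desingularization problem is of finite type over the residue field

Topic: `Literature/AlgebraicGeometry/Resolution`. Companion of `Hironaka1964LocalBlowups.lean`
(proofs only: no new notions, no new named facts). There the named fact `Hironaka1964_local`
(Hironaka 1964, Main Theorem I, over local quasi-excellent rings of residue characteristic zero,
as read by Temkin 2008) was proved equivalent to the local desingularization problem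

  (L) for every local quasi-excellent domain `S` whose residue field has characteristic zero,
      every blow-up `g : S' → Spec S` along a nonzero ideal whose non-regular points lie over
      the closed point `s` admits a desingularization,

which is the statement Temkin's Hironaka-free proof establishes (Thm. 3.4.3, p. 19). The one
scheme-theoretic step of that proof between (L) and its formal-geometric core, Cor. 3.4.2 ("Let
`X` be an integral noetherian quasi-excellent scheme of characteristic zero with a closed
subscheme `Z` such that `X_sing ⊂ Z` and `Z` is isomorphic to a `k`-scheme of finite type. Then
the pair `(X, Z)` admits a strict desingularization"), is the sentence "Note that `S'_sing` is of
finite type over `k(s)`, hence the pair `(S', S'_sing)` admits a desingularization … by the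
previous corollary" (p. 19). This file proves that sentence, sorry-free:

* `exists_lift_residueField_of_isReduced` — a reduced scheme `T` over a local scheme `Spec S`
  all of whose points lie over the closed point is a scheme over the residue field: `T → Spec S`
  factors through the closed immersion `Spec κ(s) → Spec S` (a section of `𝔪` pulls back to a
  section vanishing at every point of the reduced scheme `T`, hence to `0`);
* `exists_reducedSubscheme_finiteType_residueField` — for `f : X → Spec S` locally of finite type
  and a closed subset `Z ⊆ f⁻¹(s)`, the reduced closed subscheme on `Z` is a `κ(s)`-scheme
  locally of finite type (quasi-compact when `X` is);
* `isBlowup_local_singularLocus_finiteType` — **docking of (L) at Cor. 3.4.2**: for `S'` as in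
  (L), the singular locus `S'_sing = S' ∖ Reg S'` is closed (`S'` is of finite type over the
  quasi-excellent ring `S`, Stacks 07QU = `Stacks07QU_holds` and the J-2 property), and with its
  reduced structure it is a closed subscheme `Z ↪ S'` of finite type over the field `κ(s)` of
  characteristic zero with `|Z| = S'_sing`; together with `isBlowup_local_standing_hypotheses`
  (`S'` integral, Noetherian, quasi-excellent, residue fields of characteristic zero) these are
  exactly the hypotheses of Cor. 3.4.2 for the pair `(S', S'_sing)`, whose strict
  desingularization is `S'_reg`-admissible because `Z ∩ S'_reg = ∅`.

No named fact is introduced; Cor. 3.4.2 itself (rig-regular formal schemes, Elkik's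
algebraization) is not vendored here.

## Sources

* M. Temkin, *Desingularization of quasi-excellent schemes in characteristic zero*, Adv. Math.
  219 (2008) 488–522 = arXiv:math/0703678 (arXiv pagination): Cor. 3.4.2 (p. 18–19), proof of
  Thm. 3.4.3 (p. 19). [Temkin2008]
* H. Hironaka, *Resolution of singularities of an algebraic variety over a field of
  characteristic zero I*, Ann. of Math. 79 (1964) 109–203, Main Theorem I. [Hironaka1964]
* The Stacks Project, Tag 07QU. [StacksProject]
-/

noncomputable section

open CategoryTheory AlgebraicGeometry TopologicalSpace IsLocalRing

namespace Literature.AlgebraicGeometry.Resolution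

universe u

/-- **A reduced scheme over a local scheme whose points all lie over the closed point is a scheme
over the residue field**: if `T` is reduced and `q : T → Spec S` (quasi-compact, `S` local) maps
every point to the closed point `s`, then `q` factors through the closed immersion
`Spec κ(s) → Spec S`. Indeed a global section `a ∈ 𝔪` of `Spec S` pulls back to a section of `T`
whose non-vanishing locus `q⁻¹(D(a))` is empty, hence to `0` as `T` is reduced; so the kernel of
`Spec κ(s) → Spec S` is contained in that of `q` and the universal property of closed immersions
applies. [folklore] [cite: Temkin2008, proof of Thm. 3.4.3 (p. 19)] -/
theorem exists_lift_residueField_of_isReduced {S : Type u} [CommRing S] [IsLocalRing S]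
    {T : Scheme.{u}} [IsReduced T] (q : T ⟶ Spec (.of S)) [QuasiCompact q]
    (hq : ∀ t : T, q t = closedPoint S) :
    ∃ p : T ⟶ Spec (.of (ResidueField S)),
      p ≫ Spec.map (CommRingCat.ofHom (residue S)) = q := by
  set f : Spec (.of (ResidueField S)) ⟶ Spec (.of S) := Spec.map (CommRingCat.ofHom (residue S))
    with hf
  haveI : IsClosedImmersion f :=
    IsClosedImmersion.spec_of_surjective _ Ideal.Quotient.mk_surjective
  have H : f.ker ≤ q.ker := by
    refine Scheme.IdealSheafData.le_of_isAffine ?_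
    rw [Scheme.Hom.ker_apply, Scheme.Hom.ker_apply]
    intro a ha
    rw [RingHom.mem_ker] at ha ⊢
    -- `a ↦ 0` in `κ(s)` means `a ∈ 𝔪` (through `Γ(Spec S, ⊤) ≅ S`)
    have hmem : (Scheme.ΓSpecIso (.of S)).hom a ∈ maximalIdeal S := by
      rw [← residue_eq_zero_iff]
      have hnat := congrArg (fun φ => φ.hom a)
        (Scheme.ΓSpecIso_naturality (CommRingCat.ofHom (residue S)))
      simp only [CommRingCat.hom_comp, RingHom.comp_apply, CommRingCat.hom_ofHom] at hnat
      have ha' : (Spec.map (CommRingCat.ofHom (residue S))).appTop.hom a = 0 := ha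
      rw [← hnat, ha', map_zero]
    -- the pulled-back section vanishes at every point of the reduced scheme `T`, hence is zero
    apply eq_zero_of_basicOpen_eq_bot
    rw [← Scheme.preimage_basicOpen]
    refine le_bot_iff.mp fun t ht => ?_
    have ht' : q t ∈ (Spec (.of S)).basicOpen a := ht
    rw [hq t, basicOpen_eq_of_affine'] at ht'
    exact ((PrimeSpectrum.mem_basicOpen _ _).mp ht' hmem).elim
  exact ⟨IsClosedImmersion.lift f q H, IsClosedImmersion.lift_fac f q H⟩

/-- **A closed subset over the closed point, with its reduced structure, is of finite type over
the residue field**: for `S` local, `f : X → Spec S` locally of finite type and a closed subset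
`Z ⊆ X` with `f(Z) = {s}`, the reduced closed subscheme `X_Z` on `Z` admits a morphism
`p : X_Z → Spec κ(s)` over `Spec S`, and any such `p` is locally of finite type (as
`p ≫ (Spec κ(s) → Spec S) = (X_Z ↪ X) ≫ f` is) and quasi-compact when `X` is quasi-compact.
[folklore] [cite: Temkin2008, proof of Thm. 3.4.3 (p. 19)] -/
theorem exists_reducedSubscheme_finiteType_residueField {S : Type u} [CommRing S] [IsLocalRing S]
    {X : Scheme.{u}} (f : X ⟶ Spec (.of S)) [LocallyOfFiniteType f] [QuasiCompact f]
    (Z : Closeds X) (hZ : ∀ x ∈ Z, f x = closedPoint S) :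
    ∃ p : (Scheme.IdealSheafData.vanishingIdeal Z).subscheme ⟶ Spec (.of (ResidueField S)),
      p ≫ Spec.map (CommRingCat.ofHom (residue S)) =
        (Scheme.IdealSheafData.vanishingIdeal Z).subschemeι ≫ f ∧
      LocallyOfFiniteType p ∧ QuasiCompact p := by
  set ι := (Scheme.IdealSheafData.vanishingIdeal Z).subschemeι with hι
  haveI : IsReduced (Scheme.IdealSheafData.vanishingIdeal Z).subscheme :=
    isReduced_subscheme_vanishingIdeal Z
  have hq : ∀ t, (ι ≫ f) t = closedPoint S := fun t => by
    rw [Scheme.Hom.comp_apply]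
    exact hZ _ (mem_of_subscheme_vanishingIdeal Z t)
  obtain ⟨p, hp⟩ := exists_lift_residueField_of_isReduced (ι ≫ f) hq
  refine ⟨p, hp, ?_, ?_⟩
  · have : LocallyOfFiniteType (p ≫ Spec.map (CommRingCat.ofHom (residue S))) := by
      rw [hp]; infer_instance
    exact locallyOfFiniteType_of_comp p (Spec.map (CommRingCat.ofHom (residue S)))
  · haveI : CompactSpace X := QuasiCompact.compactSpace_of_compactSpace f
    haveI : CompactSpace (Scheme.IdealSheafData.vanishingIdeal Z).subscheme :=
      QuasiCompact.compactSpace_of_compactSpace ι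
    exact (quasiCompact_iff_compactSpace p).mpr ‹_›

/-- **Docking of the local desingularization problem (L) at Temkin 2008, Cor. 3.4.2** (proof of
Thm. 3.4.3, p. 19: "Note that `S'_sing` is of finite type over `k(s)`, hence the pair
`(S', S'_sing)` admits a desingularization `g : S'' → S'` by the previous corollary"): let `S` be
a local quasi-excellent ring with residue field `κ(s)` (in (L): a domain, `κ(s)` of characteristic
zero, the centre nonzero — none of which is needed here) and `g : S' → Spec S` a blow-up whose
non-regular points lie over the closed point. Then the singular locus `S'_sing = S' ∖ Reg S'` is
closed — `S'` is proper, in particular of finite type, over the quasi-excellent scheme `Spec S`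
(`IsBlowup.isProper`; Stacks 07QU, `Stacks07QU_holds`), so its regular locus is open (J-2,
`isClosed_compl_regularLocus_of_locallyOfFiniteType`) — and, with its reduced induced structure,
it is a closed subscheme `i : Z ↪ S'` with `|Z| = S'_sing` which is a `κ(s)`-scheme of finite type
(`exists_reducedSubscheme_finiteType_residueField`). With `isBlowup_local_standing_hypotheses`
(`S'` integral, Noetherian,
quasi-excellent, all residue fields of characteristic zero) these are the hypotheses of
Cor. 3.4.2 for the pair `(S', S'_sing)`. [cite: Temkin2008, Thm. 3.4.3 (proof, p. 19) and
Cor. 3.4.2] [cite: StacksProject, Tag 07QU] -/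
theorem isBlowup_local_singularLocus_finiteType (S : Type u) [CommRing S] [IsLocalRing S]
    (hS : IsQuasiExcellentRing S) {S' : Scheme.{u}} {g : S' ⟶ Spec (.of S)}
    {I : (Spec (.of S)).IdealSheafData} (hg : IsBlowup g I)
    (hsing : ∀ s : S', s ∉ Scheme.regularLocus S' → g s = closedPoint S) :
    IsClosed (Scheme.regularLocus S')ᶜ ∧
    ∃ (Z : Scheme.{u}) (i : Z ⟶ S') (p : Z ⟶ Spec (.of (ResidueField S))),
      IsClosedImmersion i ∧ IsReduced Z ∧ Set.range i = (Scheme.regularLocus S')ᶜ ∧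
      p ≫ Spec.map (CommRingCat.ofHom (residue S)) = i ≫ g ∧
      LocallyOfFiniteType p ∧ QuasiCompact p := by
  haveI : IsNoetherianRing S := hS.isNoetherianRing
  haveI : IsNoetherianRing (CommRingCat.of S) := ‹IsNoetherianRing S›
  haveI : IsProper g := hg.isProper
  -- `Spec S` is a quasi-excellent scheme (Stacks 07QU), so `Reg S'` is open (J-2)
  have hk : Scheme.IsQuasiExcellent (Spec (.of S)) :=
    Scheme.isQuasiExcellent_of_locallyOfFiniteType_of_isQuasiExcellentRing Stacks07QU_holds hS
      (𝟙 (Spec (.of S)))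
  have hc : IsClosed (Scheme.regularLocus S')ᶜ :=
    isClosed_compl_regularLocus_of_locallyOfFiniteType g hk
  refine ⟨hc, ?_⟩
  -- the reduced closed subscheme on `S'_sing`, a closed subset of the closed fibre
  let T : Closeds S' := ⟨(Scheme.regularLocus S')ᶜ, hc⟩
  have hT : ∀ x ∈ T, g x = closedPoint S := fun x hx => hsing x hx
  obtain ⟨p, hp, hft, hqc⟩ := exists_reducedSubscheme_finiteType_residueField g T hT
  exact ⟨(Scheme.IdealSheafData.vanishingIdeal T).subscheme,
    (Scheme.IdealSheafData.vanishingIdeal T).subschemeι, p, inferInstance,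
    isReduced_subscheme_vanishingIdeal T, range_subschemeι_vanishingIdeal T, hp, hft, hqc⟩

end Literature.AlgebraicGeometry.Resolution

end
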